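import Summits.QuantumFields.YangMills.Theorems.BalabanUVNodesN16HolderMSLeafSlot
import Summits.QuantumFields.YangMills.Theorems.BalabanUVNodesN16HolderMSOfSocketsAllTorusPinned
import Summits.QuantumFields.YangMills.Theorems.BalabanUVNodesN16OfSocketsAllTorusPinned

/-!
# Route «BalabanUVNodes», cluster K4 «SpineRates» — node N16 = NE3: THE RECORD-LEVEL LEAF SLOTS RE-KEYED AT THE ALL-TORUS PROPER SUB-INDEX (R-b″ on N16's
# record side) — `LeafSlotHolderAT c β` ∕ `LeafSlotAT c` ∕ `LeafSlotHolderMSAT c β`: this seat's `LeafSlot` (p466652), dag-n16-c's `LeafSlotHolder` (E2) and this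
# seat's `LeafSlotHolderMS` (E2-MS, p499662) VERBATIM but with node N05's two conjuncts `B8.Thm4Body` ∕ `B8.Prop3Body` asked on the sub-family
# `{i : ZdIdx 4 c.L // (∀ j, i.Ω j = univ) ∧ (∀ m j, i.Λs m j = {y | j = m}) ∧ (∀ m j, i.Λb m j = {c | j = m}) ∧ i.η = ((c.L : ℝ)⁻¹) ^ i.k}` of `zdGF3 (M_N ℂ) c.L β len`
# (the ALL-TORUS members with CANONICAL truncation data at the PINNED spacing `η = L^{−k}` — dag-n16-c's F47∕F48 key, every member inside n05-c's record sub-index `IdxB8SubB`)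
# instead of the whole univ sub-family `{i // i.Ω 0 = univ}`; the restrictions univ ⇒ AT, the bridges to the print slots, the closers

Cell `pub-ymgap`, seat `pub-ymgap-dag-n16-e` (R134 acceleration seat (a), strategy s2 = BY-NAME KNIT at the record; HUMAN RULING D-0062; chair R424 venue), generation 7,
module 32 (DEFINITION lane: 3 `def` + bookkeeping theorems; 0 `sorry`; standard axioms).  `--supports <K3 id of record> --as helper` (dag-lead KEY MAP).
`bears_on: R4∕N16 · edge N05 → N16 · out-edge N16 → N21`.  Over this seat's (E2-MS) `…N16HolderMSLeafSlot` (through it dag-n16-c's (E2) `…N16HolderLeafSlot`, (E1)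
`…N16HolderRegime` (`PrintSlotHolder`, `printSlotHolder_one_iff`, `InEndRegimeH`, closers), (E1-MS) `…N16HolderMSRegime`, this seat's `…N16LeafSlot` ∕ `…N16RegimeDefs`
(`LeafSlot`, `PrintSlot`, `InEndRegime`, `n16At_of_inEndRegime_printSlot`), `…N16HolderMSTorusOfZd` (`thm4TorusAt_printMS_of_zd`), `…N16Thm4Torus…` (`thm4TorusAt_print_of_zd`))
and dag-n16-c g6's R-b″ modules F47 `…N16OfSocketsAllTorusPinned` (`idxB8LawsB_allTorusPinned`, `thm4TorusAt_print_of_leaf_allTorusPinned {β}`) ∕ F48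
`…N16HolderMSOfSocketsAllTorusPinned` (`thm4TorusAt_printMS_of_leaf_allTorusPinned`) — the PINNED key (pub-ymgap INBOX DAGN16C-G6-REPLY-N16E: F45∕F46's unpinned sub-index leaves
the spacing `i.η` free and asks N05 outside its record; N16 reads the leaf only at `η = L^{−k}`).  Restates nothing: three NEW slot predicates (the univ-keyed ones stay the slots of the landed modules; `…AT` are weaker hypotheses).

WHY (LOCATED-4 of this seat, pub-ymgap INBOX DAGN16E-G7-LOCATED-4, 2026-08-27; after dag-n16-c g6 `B8SockH59NotAtUnivDegenerate` p511253 + F45∕F46).  n16-c certified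
that the typed index `ZdIdx` leaves the truncation data below the top level free, so the univ sub-family `{i // i.Ω 0 = univ}` contains members with EMPTY lower
truncations at which n05-a's socket `SockH59` is FALSE; n05-a's sound Theorem-4 currency is therefore PER MEMBER at PROPER members, and n16-c re-keyed N16's raw END
tops at the all-torus proper sub-index (R-b″: `n16_of_leafAllTorus(Pinned)`, `n16_of_socketsAllTorus(Pinned)`).  The record-level slots of the landed N16 kit (`LeafSlot`,
`LeafSlotHolder`, `LeafSlotHolderMS`) — and with them every «THE N16 LINE» theorem of this seat (modules 17∕18∕20∕23∕26∕27∕28, their ⁗∕Core twins, 21ᴳ∕29ᴳ) — ask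
`Thm4Body` ∕ `Prop3Body` at EVERY univ member, including degenerate ones no printed supplier serves — and n16-c's F49 `B8Prop3BodyNotAtEmptyBonds.not_prop3Printed_zdGF3_univ`
(LOCATED-5, 2026-08-27) even REFUTES the `Prop3Body` conjunct at the empty-bond univ members: the univ-keyed slots are UNSATISFIABLE and every line over them VACUOUS as stated.  The closers, however, USE N05's conjuncts ONLY at the
all-torus proper member of each level (`thm4TorusAt_zero_print_of_leaf_member` at the member of `exists_member_univ`), so the slots re-keyed at that sub-index close
EXACTLY as before (F47∕F48 supply the β-generic ∕ multi-scale `ℤᵈ` step at the pinned spacing) while their N05 conjunct is now the one n16-c's F47 §3 ∕ n05-a's per-member currency over `IdxB8SubB`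
produces.  The univ-keyed slots imply the AT-keyed ones (restriction along the sub-index inclusion, `Thm4Body` ∕ `Prop3Body` being `∀ i`-statements), so every landed
univ-keyed theorem is formally a corollary (now with an unsatisfiable hypothesis); the AT-keyed N16 LINES (modules 33–36 of this generation) are the LIVE statements — the pinned
members have non-empty canonical bonds `Λb m j = {j = m}` (F49's witness excluded) and lie inside n05-c's record sub-index `IdxB8SubB` (F47 §1).

WHAT THIS FILE DECLARES.  §1 `LeafSlotHolderAT c β` · `LeafSlotAT c := LeafSlotHolderAT c 1` (`leafSlotAT_iff`, `Iff.rfl`) · `LeafSlotHolderMSAT c β`;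
§2 restrictions `leafSlotHolderAT_of_leafSlotHolder` · `leafSlotAT_of_leafSlot` · `leafSlotHolderMSAT_of_leafSlotHolderMS` · MS ⇒ β `leafSlotHolderAT_of_leafSlotHolderMSAT`
· `leafSlotAT_of_leafSlotHolderMSAT_one`; §3 bridges `printSlotHolder_of_leafSlotHolderAT` (`2 ≤ c.L`, `0 ≤ β`; F47) · `printSlot_of_leafSlotAT` · `printSlotHolderMS_of_leafSlotHolderMSAT`
(F48); §4 closers `n16HolderAt_of_inEndRegimeH_leafSlotHolderAT` (`0 ≤ β ≤ 1`) · `n16At_of_inEndRegime_leafSlotAT` · `n16At_of_inEndRegimeH_leafSlotAT` ·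
`n16HolderMSAt_of_inEndRegimeHMS_leafSlotHolderMSAT` · `n16HolderAt_of_inEndRegimeHMS_leafSlotHolderAT` · `n16At_of_inEndRegimeHMS_leafSlotAT`; §5 the `RRec`-generic knits
`s_N16Holder_of_inEndRegimeH_leafSlotHolderAT` · `s_N16_of_inEndRegime_leafSlotAT` · `s_N16HolderMS_of_inEndRegimeHMS_leafSlotHolderMSAT`.
HONEST FRAMING: definitions and bookkeeping; the three slots are hypothesis SHAPES (node N05's [Balaban1985RegularSpaces] Thm 4 ∕ Prop 3 as typed by n05-a at the all-torus
proper members, at a printed Hölder exponent; N07's [Balaban1985Variational] Thm 1 (8)+(10) TYPE) asserted for no bundle; nothing of Bałaban's proved; no admissible tuple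
of any record edition claimed; **N16 ∕ NE3 NOT discharged**; the Hölder-pin ruling (R-β ∕ R-β″) and the socket owner's index law are the director's ∕ N05's; count-neutral
(typed 28∕28 · discharged 5∕27, A 5∕28 UNMOVED); one finite four-torus at fixed ε — NOT ℝ⁴, NOT infinite volume, NOT OS, NOT a mass gap, NOT Clay.
-/

set_option autoImplicit false

open scoped BigOperators Matrix Matrix.Norms.L2Operator
open NormedSpace

namespace Summit.QuantumFields.YangMills.BalabanUVNodes.N16LeafSlotAllTorus

open Literature.MathematicalPhysics.QuantumFieldTheory.Balaban1983to89
open Literature.MathematicalPhysics.QuantumFieldTheory.Balaban1983to89.T4Continuum (T4Family ULoop)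
open B7Prop1Explicit B7Prop2Explicit
open B7Prop3Flat (c3)
open B7Eq92Concrete (mgauge)
open B8Ineq132 (covDerivFwd)
open B8Eq184Proof (cfgExp)
open B8Eq119TwistedAxial (Restr129)
open B8Eq133Hypotheses (Reg335Zd)
open B8Eq138LandauZd (IsLandau138 covLap)
open B8Thm4TorusAt (torusLam Thm4TorusAt)
open B8LeafModelZd (ZdIdx)
open B8LeafModelZd3 (zdGF3)
open Summit.QuantumFields.BalabanUV.T4Continuum
open T4AveragingDeficitWall (Ad)
open MinimalActionRate (sfClass)
open BlockAverageCurrent (curConst)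
open NE3RightInverseSupLetters (frameC)
open NE3.LeafIndexSockets (LeafH3sup)
open YMDAG.UVSplit (Datum NE3Carriers RateCarriers RateRecordPred N16At S_N16)
open Summit.QuantumFields.YangMills.BalabanUVNodes.N16Regime (PrintSlot InEndRegime n16At_of_inEndRegime_printSlot)
open Summit.QuantumFields.YangMills.BalabanUVNodes.N16LeafSlot (LeafSlot)
open Summit.QuantumFields.YangMills.BalabanUVNodes.N16HolderDefs (N16HolderAt S_N16Holder n16HolderAt_one_iff)
open Summit.QuantumFields.YangMills.BalabanUVNodes.N16HolderMSDefs (N16HolderMSAt S_N16HolderMS)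
open Summit.QuantumFields.YangMills.BalabanUVNodes.N16HolderRegime (PrintSlotHolder InEndRegimeH printSlotHolder_one_iff n16HolderAt_of_inEndRegimeH_printSlotHolder
  inEndRegime_of_inEndRegimeH)
open Summit.QuantumFields.YangMills.BalabanUVNodes.N16HolderLeafSlot (LeafSlotHolder leafSlotHolder_one_iff)
open Summit.QuantumFields.YangMills.BalabanUVNodes.N16HolderMSRegime (PrintSlotHolderMS InEndRegimeHMS n16HolderMSAt_of_inEndRegimeHMS_printSlotHolderMS
  inEndRegimeH_of_inEndRegimeHMS)
open Summit.QuantumFields.YangMills.BalabanUVNodes.N16HolderMSLeafSlot (LeafSlotHolderMS)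
open Summit.QuantumFields.YangMills.BalabanUVNodes.N16 (thm4TorusAt_print_of_zd)
open Summit.QuantumFields.YangMills.BalabanUVNodes.N16HolderMSTorusOfZd (thm4TorusAt_printMS_of_zd)
open Summit.QuantumFields.YangMills.BalabanUVNodes.N16OfSocketsAllTorusPinned (thm4TorusAt_print_of_leaf_allTorusPinned)
open Summit.QuantumFields.YangMills.BalabanUVNodes.N16HolderMSOfSocketsAllTorusPinned (thm4TorusAt_printMS_of_leaf_allTorusPinned)

noncomputable section

/-! ## §1 The three leaf slots keyed at the all-torus proper sub-index -/

/-- **THE LEAF β-SLOT AT A BUNDLE, ALL-TORUS PROPER SUB-INDEX** — dag-n16-c's `LeafSlotHolder c β` VERBATIM with node N05's conjuncts `B8.Thm4Body c₁ B₁′` ∕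
`B8.Prop3Body cP 4 c.L C₂ inp B₀β` asked on `fun i : {i : ZdIdx 4 c.L // (∀ j, i.Ω j = univ) ∧ (∀ m j, i.Λs m j = {y | j = m}) ∧ (∀ m j, i.Λb m j = {c | j = m})} ↦
zdGF3 (M_N ℂ) c.L β len i.1` restricted further to the PINNED spacing `i.η = ((c.L : ℝ)⁻¹) ^ i.k` (the all-torus members with canonical truncation data at `η = L^{−k}` — the ONLY
members the closers use, all inside n05-c's record sub-index `IdxB8SubB`, served by n05-a's per-member Theorem-4 currency) instead of the whole univ sub-family; N07's `LeafH3sup` and every letter line unchanged.  A hypothesis SHAPE — asserted for no bundle here.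
[cite: Balaban1985RegularSpaces, Thm 4 p.88, Prop. 3 p.87, (1.36) p.82, p.77 («Ω_j = T_η»)] -/
@[folklore]
def LeafSlotHolderAT {N : ℕ} (c : NE3Carriers N) (β : ℝ) : Prop :=
  letI : CStarAlgebra (Matrix (Fin N) (Fin N) ℂ) := {}
  ∃ (len : Site 4 → ℝ) (c₁ c₁' B₁' cP C₂ B₀β : ℝ) (inp : B8.B9Inputs) (B Bh b' c' α Mc C335 : ℝ) (𝒬 : ℕ → Set (Set (Site 4) × ℕ)),
    (∀ v : Site 4, 0 < len v → 1 ≤ len v) ∧ (∀ μ : Fin 4, len (e μ) = 1) ∧ 0 < B₁' ∧ 5 * ((4 : ℕ) : ℝ) * c.L * inp.B₀ ≤ B₁' ∧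
    B = 5 * ((4 : ℕ) : ℝ) * c.L * inp.B₀ ∧ Bh = 5 * ((4 : ℕ) : ℝ) * c.L * B₀β ∧ 16 * (B * c₁') ≤ 1 ∧
    (∀ α₀ α₁ : ℝ, 0 < α₀ → 0 < α₁ → α₀ + α₁ ≤ c₁' →
      α₀ + α₁ ≤ c₁ ∧ C0 4 * (2 * α₀) ≤ 1 / 3 ∧ 4 * α₀ ≤ c2' 4 c.L ∧ 16 * (B₁' * (α₀ + α₁)) ≤ 1 ∧
      Real.exp (4 * (800 * (((4 : ℕ) : ℝ) + 1) ^ 2 * (((4 : ℕ) : ℝ) + 4)) * α₀) * (1 + 8 * (131072 * (((4 : ℕ) : ℝ) + 1) ^ 2) * (B₁' * (α₀ + α₁))) ≤ 2 ∧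
      2 * (B₁' * (α₀ + α₁)) ≤ c3 4 c.L ∧ ((4 : ℕ) : ℝ) * c.L * α₁ ≤ 1 / 8 ∧ α₀ ≤ cP ∧ α₁ ≤ cP ∧ B₁' * (α₀ + α₁) ≤ cP ∧
      2 * (B₁' * (α₀ + α₁)) ^ 2 + 20 * ((4 : ℕ) : ℝ) * α₀ * (B₁' * (α₀ + α₁)) + 2 * C₂ * (B₁' * (α₀ + α₁)) ^ 2 ≤ α₀ + α₁) ∧
    0 ≤ b' ∧ 0 ≤ c' ∧ 2 ^ 15 * ((4 : ℝ) + 1) ^ 2 * ((4 : ℝ) + 4) ^ 2 * (c.L : ℝ) ^ 2 * b' ≤ 1 ∧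
    23040 * (4 : ℝ) ^ 4 * (frameC 4 c.L + 4) ^ 3 * (c' + curConst 4 c.L * b' ^ 2) ≤ 1 ∧
    0 < α ∧ C0 4 * α ≤ 1 / 3 ∧ 2 * α ≤ c2' 4 c.L ∧ 11 * (4 : ℝ) ^ 2 * α ≤ 1 / 6 ∧ α + 11 * (4 : ℝ) ^ 2 * α ≤ c₁' ∧
    (b' + 226 * (8 * ((4 : ℝ) + 1) * ((4 : ℝ) + 4)) ^ 2 * b' ^ 2) < α ∧ 4 * ((4 : ℝ) - 1) * (c' + curConst 4 c.L * b' ^ 2) < α ∧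
    0 ≤ Mc ∧ (Mc + 1) * (b' + 226 * (8 * ((4 : ℝ) + 1) * ((4 : ℝ) + 4)) ^ 2 * b' ^ 2) ≤ 1 / 2 ∧
    (∀ k, ∀ q ∈ 𝒬 k, q.2 ≤ k ∧ ∃ y : Site 4, ∀ z ∈ q.1, (l1 (z - y) : ℝ) ≤ Mc * (c.L : ℝ) ^ q.2) ∧
    2 * (Mc + 1) * (b' + 226 * (8 * ((4 : ℝ) + 1) * ((4 : ℝ) + 4)) ^ 2 * b' ^ 2) + 2 * Mc * (2 * (c' + curConst 4 c.L * b' ^ 2)) +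
      4 * Mc * (1 + 2 * Mc) * (b' + 226 * (8 * ((4 : ℝ) + 1) * ((4 : ℝ) + 4)) ^ 2 * b' ^ 2) ^ 2 < C335 ∧
    c.ε < α ∧ B * (α + 11 * (4 : ℝ) ^ 2 * α) ≤ c.Λ₁ ∧
    B * (α + 11 * (4 : ℝ) ^ 2 * α) + 2 * (b' + 226 * (8 * ((4 : ℝ) + 1) * ((4 : ℝ) + 4)) ^ 2 * b' ^ 2) * c.Λ₁ ≤ c.Λ₁ ∧
    B * (α + 11 * (4 : ℝ) ^ 2 * α) + 16 * (b' + 226 * (8 * ((4 : ℝ) + 1) * ((4 : ℝ) + 4)) ^ 2 * b' ^ 2) * (B * (α + 11 * (4 : ℝ) ^ 2 * α)) ≤ c.Λ₁ ∧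
    Bh * (α + 11 * (4 : ℝ) ^ 2 * α) + 8 * (b' + 226 * (8 * ((4 : ℝ) + 1) * ((4 : ℝ) + 4)) ^ 2 * b' ^ 2) * (B * (α + 11 * (4 : ℝ) ^ 2 * α)) ≤ c.Λ₂' ∧
    B8.Thm4Body c₁ B₁' (fun i : {i : ZdIdx 4 c.L // (∀ j, i.Ω j = Set.univ) ∧ (∀ m j, i.Λs m j = {_y | j = m}) ∧ (∀ m j, i.Λb m j = {_c | j = m}) ∧ i.η = ((c.L : ℝ)⁻¹) ^ i.k} => (zdGF3 (Matrix (Fin N) (Fin N) ℂ) c.L β len i.1).toGFData) ∧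
    B8.Prop3Body cP 4 (c.L : ℝ) C₂ inp B₀β (fun i : {i : ZdIdx 4 c.L // (∀ j, i.Ω j = Set.univ) ∧ (∀ m j, i.Λs m j = {_y | j = m}) ∧ (∀ m j, i.Λb m j = {_c | j = m}) ∧ i.η = ((c.L : ℝ)⁻¹) ^ i.k} => (zdGF3 (Matrix (Fin N) (Fin N) ℂ) c.L β len i.1).toGFData2) ∧
    LeafH3sup 4 c.L c.Nper c.ε b' c' c.dom

/-- **THE LEAF SLOT OF RECORD (β = 1), ALL-TORUS PROPER SUB-INDEX** := `LeafSlotHolderAT c 1` (this seat's `LeafSlot c` re-keyed; cf. dag-n16-c's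
`leafSlotHolder_one_iff : LeafSlotHolder c 1 ↔ LeafSlot c`). [folklore] -/
@[folklore]
def LeafSlotAT {N : ℕ} (c : NE3Carriers N) : Prop :=
  LeafSlotHolderAT c 1

/-- `LeafSlotAT c ↔ LeafSlotHolderAT c 1` (`Iff.rfl`). [folklore] -/
theorem leafSlotAT_iff {N : ℕ} (c : NE3Carriers N) : LeafSlotAT c ↔ LeafSlotHolderAT c 1 :=
  Iff.rfl

/-- **THE MS LEAF β-SLOT AT A BUNDLE, ALL-TORUS PROPER SUB-INDEX** — this seat's `LeafSlotHolderMS c β` (length letter `∀ μ j, len (j • e μ) = j`, Hölder threshold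
`10·`) VERBATIM with N05's two conjuncts asked on the PINNED all-torus proper sub-family of `zdGF3 (M_N ℂ) c.L β len`.  A hypothesis SHAPE — asserted for no bundle here.
[cite: Balaban1985RegularSpaces, Thm 4 p.88, Prop. 3 p.87, (1.36) p.82, p.77] -/
@[folklore]
def LeafSlotHolderMSAT {N : ℕ} (c : NE3Carriers N) (β : ℝ) : Prop :=
  letI : CStarAlgebra (Matrix (Fin N) (Fin N) ℂ) := {}
  ∃ (len : Site 4 → ℝ) (c₁ c₁' B₁' cP C₂ B₀β : ℝ) (inp : B8.B9Inputs) (B Bh b' c' α Mc C335 : ℝ) (𝒬 : ℕ → Set (Set (Site 4) × ℕ)),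
    (∀ v : Site 4, 0 < len v → 1 ≤ len v) ∧ (∀ (μ : Fin 4) (j : ℕ), len (j • e μ) = j) ∧ 0 < B₁' ∧ 5 * ((4 : ℕ) : ℝ) * c.L * inp.B₀ ≤ B₁' ∧
    B = 5 * ((4 : ℕ) : ℝ) * c.L * inp.B₀ ∧ Bh = 5 * ((4 : ℕ) : ℝ) * c.L * B₀β ∧ 16 * (B * c₁') ≤ 1 ∧
    (∀ α₀ α₁ : ℝ, 0 < α₀ → 0 < α₁ → α₀ + α₁ ≤ c₁' →
      α₀ + α₁ ≤ c₁ ∧ C0 4 * (2 * α₀) ≤ 1 / 3 ∧ 4 * α₀ ≤ c2' 4 c.L ∧ 16 * (B₁' * (α₀ + α₁)) ≤ 1 ∧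
      Real.exp (4 * (800 * (((4 : ℕ) : ℝ) + 1) ^ 2 * (((4 : ℕ) : ℝ) + 4)) * α₀) * (1 + 8 * (131072 * (((4 : ℕ) : ℝ) + 1) ^ 2) * (B₁' * (α₀ + α₁))) ≤ 2 ∧
      2 * (B₁' * (α₀ + α₁)) ≤ c3 4 c.L ∧ ((4 : ℕ) : ℝ) * c.L * α₁ ≤ 1 / 8 ∧ α₀ ≤ cP ∧ α₁ ≤ cP ∧ B₁' * (α₀ + α₁) ≤ cP ∧
      2 * (B₁' * (α₀ + α₁)) ^ 2 + 20 * ((4 : ℕ) : ℝ) * α₀ * (B₁' * (α₀ + α₁)) + 2 * C₂ * (B₁' * (α₀ + α₁)) ^ 2 ≤ α₀ + α₁) ∧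
    0 ≤ b' ∧ 0 ≤ c' ∧ 2 ^ 15 * ((4 : ℝ) + 1) ^ 2 * ((4 : ℝ) + 4) ^ 2 * (c.L : ℝ) ^ 2 * b' ≤ 1 ∧
    23040 * (4 : ℝ) ^ 4 * (frameC 4 c.L + 4) ^ 3 * (c' + curConst 4 c.L * b' ^ 2) ≤ 1 ∧
    0 < α ∧ C0 4 * α ≤ 1 / 3 ∧ 2 * α ≤ c2' 4 c.L ∧ 11 * (4 : ℝ) ^ 2 * α ≤ 1 / 6 ∧ α + 11 * (4 : ℝ) ^ 2 * α ≤ c₁' ∧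
    (b' + 226 * (8 * ((4 : ℝ) + 1) * ((4 : ℝ) + 4)) ^ 2 * b' ^ 2) < α ∧ 4 * ((4 : ℝ) - 1) * (c' + curConst 4 c.L * b' ^ 2) < α ∧
    0 ≤ Mc ∧ (Mc + 1) * (b' + 226 * (8 * ((4 : ℝ) + 1) * ((4 : ℝ) + 4)) ^ 2 * b' ^ 2) ≤ 1 / 2 ∧
    (∀ k, ∀ q ∈ 𝒬 k, q.2 ≤ k ∧ ∃ y : Site 4, ∀ z ∈ q.1, (l1 (z - y) : ℝ) ≤ Mc * (c.L : ℝ) ^ q.2) ∧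
    2 * (Mc + 1) * (b' + 226 * (8 * ((4 : ℝ) + 1) * ((4 : ℝ) + 4)) ^ 2 * b' ^ 2) + 2 * Mc * (2 * (c' + curConst 4 c.L * b' ^ 2)) +
      4 * Mc * (1 + 2 * Mc) * (b' + 226 * (8 * ((4 : ℝ) + 1) * ((4 : ℝ) + 4)) ^ 2 * b' ^ 2) ^ 2 < C335 ∧
    c.ε < α ∧ B * (α + 11 * (4 : ℝ) ^ 2 * α) ≤ c.Λ₁ ∧
    B * (α + 11 * (4 : ℝ) ^ 2 * α) + 2 * (b' + 226 * (8 * ((4 : ℝ) + 1) * ((4 : ℝ) + 4)) ^ 2 * b' ^ 2) * c.Λ₁ ≤ c.Λ₁ ∧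
    B * (α + 11 * (4 : ℝ) ^ 2 * α) + 16 * (b' + 226 * (8 * ((4 : ℝ) + 1) * ((4 : ℝ) + 4)) ^ 2 * b' ^ 2) * (B * (α + 11 * (4 : ℝ) ^ 2 * α)) ≤ c.Λ₁ ∧
    Bh * (α + 11 * (4 : ℝ) ^ 2 * α) + 10 * (b' + 226 * (8 * ((4 : ℝ) + 1) * ((4 : ℝ) + 4)) ^ 2 * b' ^ 2) * (B * (α + 11 * (4 : ℝ) ^ 2 * α)) ≤ c.Λ₂' ∧
    B8.Thm4Body c₁ B₁' (fun i : {i : ZdIdx 4 c.L // (∀ j, i.Ω j = Set.univ) ∧ (∀ m j, i.Λs m j = {_y | j = m}) ∧ (∀ m j, i.Λb m j = {_c | j = m}) ∧ i.η = ((c.L : ℝ)⁻¹) ^ i.k} => (zdGF3 (Matrix (Fin N) (Fin N) ℂ) c.L β len i.1).toGFData) ∧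
    B8.Prop3Body cP 4 (c.L : ℝ) C₂ inp B₀β (fun i : {i : ZdIdx 4 c.L // (∀ j, i.Ω j = Set.univ) ∧ (∀ m j, i.Λs m j = {_y | j = m}) ∧ (∀ m j, i.Λb m j = {_c | j = m}) ∧ i.η = ((c.L : ℝ)⁻¹) ^ i.k} => (zdGF3 (Matrix (Fin N) (Fin N) ℂ) c.L β len i.1).toGFData2) ∧
    LeafH3sup 4 c.L c.Nper c.ε b' c' c.dom

/-! ## §2 Restrictions: the univ-keyed slots imply the AT-keyed ones; MS ⇒ β at the sub-index -/

section Restrictions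

variable {N : ℕ} (c : NE3Carriers N)

/-- **`LeafSlotHolder c β → LeafSlotHolderAT c β`**: `Thm4Body` ∕ `Prop3Body` are `∀ i`-statements, so they restrict along the inclusion of the all-torus proper
members at the pinned spacing into the univ sub-family (`i.Ω 0 = univ` from `∀ j, i.Ω j = univ`). [folklore] -/
theorem leafSlotHolderAT_of_leafSlotHolder {β : ℝ} (h : LeafSlotHolder c β) : LeafSlotHolderAT c β := by
  letI : CStarAlgebra (Matrix (Fin N) (Fin N) ℂ) := {}
  obtain ⟨len, c₁, c₁', B₁', cP, C₂, B₀β, inp, B, Bh, b', c', α, Mc, C335, 𝒬, hlen, hlen1, hB₁', hBB, hBdef, hBhdef, hBc, hwin,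
    hb', hc', hRb, hcF, hα, hA3, hA2, hAs, hAc, hb'α, hc'α, hMc, hMcα, h𝒬, hC335, hεα, hss, hgrad, hℓ, hhol, hT, hP, h3⟩ := h
  exact ⟨len, c₁, c₁', B₁', cP, C₂, B₀β, inp, B, Bh, b', c', α, Mc, C335, 𝒬, hlen, hlen1, hB₁', hBB, hBdef, hBhdef, hBc, hwin,
    hb', hc', hRb, hcF, hα, hA3, hA2, hAs, hAc, hb'α, hc'α, hMc, hMcα, h𝒬, hC335, hεα, hss, hgrad, hℓ, hhol,
    fun i => hT ⟨i.1, i.2.1 0⟩, fun i => hP ⟨i.1, i.2.1 0⟩, h3⟩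

/-- **`LeafSlot c → LeafSlotAT c`** (the slot of record restricts to the all-torus proper sub-index). [folklore] -/
theorem leafSlotAT_of_leafSlot (h : LeafSlot c) : LeafSlotAT c :=
  leafSlotHolderAT_of_leafSlotHolder c ((leafSlotHolder_one_iff c).mpr h)

/-- **`LeafSlotHolderMS c β → LeafSlotHolderMSAT c β`** (restriction, MS letters). [folklore] -/
theorem leafSlotHolderMSAT_of_leafSlotHolderMS {β : ℝ} (h : LeafSlotHolderMS c β) : LeafSlotHolderMSAT c β := by
  letI : CStarAlgebra (Matrix (Fin N) (Fin N) ℂ) := {}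
  obtain ⟨len, c₁, c₁', B₁', cP, C₂, B₀β, inp, B, Bh, b', c', α, Mc, C335, 𝒬, hlen, hlenj, hB₁', hBB, hBdef, hBhdef, hBc, hwin,
    hb', hc', hRb, hcF, hα, hA3, hA2, hAs, hAc, hb'α, hc'α, hMc, hMcα, h𝒬, hC335, hεα, hss, hgrad, hℓ, hhol, hT, hP, h3⟩ := h
  exact ⟨len, c₁, c₁', B₁', cP, C₂, B₀β, inp, B, Bh, b', c', α, Mc, C335, 𝒬, hlen, hlenj, hB₁', hBB, hBdef, hBhdef, hBc, hwin,
    hb', hc', hRb, hcF, hα, hA3, hA2, hAs, hAc, hb'α, hc'α, hMc, hMcα, h𝒬, hC335, hεα, hss, hgrad, hℓ, hhol,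
    fun i => hT ⟨i.1, i.2.1 0⟩, fun i => hP ⟨i.1, i.2.1 0⟩, h3⟩

/-- **MS ⇒ β AT THE SUB-INDEX — `LeafSlotHolderMSAT c β → LeafSlotHolderAT c β`**: the length letter at `j = 1` is `len (e μ) = 1` (`one_smul`), and the `10·` Hölder
threshold implies the `8·` one (both summands non-negative) — this seat's `leafSlotHolder_of_leafSlotHolderMS` verbatim at the sub-index. [folklore] -/
theorem leafSlotHolderAT_of_leafSlotHolderMSAT {β : ℝ} (h : LeafSlotHolderMSAT c β) : LeafSlotHolderAT c β := by
  letI : CStarAlgebra (Matrix (Fin N) (Fin N) ℂ) := {}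
  obtain ⟨len, c₁, c₁', B₁', cP, C₂, B₀β, inp, B, Bh, b', c', α, Mc, C335, 𝒬, hlen, hlenj, hB₁', hBB, hBdef, hBhdef, hBc, hwin,
    hb', hc', hRb, hcF, hα, hA3, hA2, hAs, hAc, hb'α, hc'α, hMc, hMcα, h𝒬, hC335, hεα, hss, hgrad, hℓ, hhol, hT, hP, h3⟩ := h
  have hlen1 : ∀ μ : Fin 4, len (e μ) = 1 := fun μ => by simpa only [one_smul, Nat.cast_one] using hlenj μ 1
  have hB0 : 0 ≤ B := by rw [hBdef]; have := inp.B₀_pos.le; positivity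
  have hX0 : 0 ≤ B * (α + 11 * (4 : ℝ) ^ 2 * α) := mul_nonneg hB0 (by positivity)
  have hab : 0 ≤ b' + 226 * (8 * ((4 : ℝ) + 1) * ((4 : ℝ) + 4)) ^ 2 * b' ^ 2 := by positivity
  have hhol8 : Bh * (α + 11 * (4 : ℝ) ^ 2 * α) + 8 * (b' + 226 * (8 * ((4 : ℝ) + 1) * ((4 : ℝ) + 4)) ^ 2 * b' ^ 2) * (B * (α + 11 * (4 : ℝ) ^ 2 * α))
      ≤ c.Λ₂' := by nlinarith [mul_nonneg hab hX0]
  exact ⟨len, c₁, c₁', B₁', cP, C₂, B₀β, inp, B, Bh, b', c', α, Mc, C335, 𝒬, hlen, hlen1, hB₁', hBB, hBdef, hBhdef, hBc, hwin,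
    hb', hc', hRb, hcF, hα, hA3, hA2, hAs, hAc, hb'α, hc'α, hMc, hMcα, h𝒬, hC335, hεα, hss, hgrad, hℓ, hhol8, hT, hP, h3⟩

/-- **`LeafSlotHolderMSAT c 1 → LeafSlotAT c`** (MS ⇒ the slot of record, at the sub-index). [folklore] -/
theorem leafSlotAT_of_leafSlotHolderMSAT_one (h : LeafSlotHolderMSAT c 1) : LeafSlotAT c :=
  leafSlotHolderAT_of_leafSlotHolderMSAT c h

end Restrictions

/-! ## §3 The AT-keyed leaf slots imply the print slots (dag-n16-c's R-b″ `ℤᵈ` steps F47 ∕ F48 at the pinned spacing + the periodicity principle) -/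

section Bridges

variable {N : ℕ} [NeZero N] (c : NE3Carriers N)

/-- **`LeafSlotHolderAT c β → PrintSlotHolder c β`** (`2 ≤ c.L`, `0 ≤ β`) — dag-n16-c's `printSlotHolder_of_leafSlotHolder` with the univ-keyed `ℤᵈ` step replaced by
F47's `thm4TorusAt_print_of_leaf_allTorusPinned` (N05's conjuncts read at the pinned all-torus proper member of each level only), then `thm4TorusAt_print_of_zd` (β-generic
periodicity principle); the other conjuncts carried verbatim with `c₁ := c₁′`. [folklore] -/
theorem printSlotHolder_of_leafSlotHolderAT (hL : 2 ≤ c.L) {β : ℝ} (hβ : 0 ≤ β) (h : LeafSlotHolderAT c β) : PrintSlotHolder c β := by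
  letI : CStarAlgebra (Matrix (Fin N) (Fin N) ℂ) := {}
  haveI : Nonempty (Fin N) := ⟨⟨0, Nat.pos_of_ne_zero (NeZero.ne N)⟩⟩
  obtain ⟨len, c₁, c₁', B₁', cP, C₂, B₀β, inp, B, Bh, b', c', α, Mc, C335, 𝒬, hlen, hlen1, hB₁', hBB, hBdef, hBhdef, hBc, hwin,
    hb', hc', hRb, hcF, hα, hA3, hA2, hAs, hAc, hb'α, hc'α, hMc, hMcα, h𝒬, hC335, hεα, hss, hgrad, hℓ, hhol, hT, hP, h3⟩ := h
  have hL1 : 1 ≤ c.L := le_trans one_le_two hL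
  have hB0 : 0 ≤ B := by rw [hBdef]; have := inp.B₀_pos.le; positivity
  have hzd := thm4TorusAt_print_of_leaf_allTorusPinned (d := 4) (n := Fin N) (by norm_num) hL hβ hlen hlen1 hB₁' hBB hwin
    (fun k => Reg335Zd (((c.L : ℝ) ^ k)⁻¹) c.L (𝒬 k) C335) hT hP
  refine ⟨c₁', B, Bh, b', c', α, Mc, C335, 𝒬, hb', hc', hRb, hcF, hα, hA3, hA2, hAs, hAc, hb'α, hc'α, hMc, hMcα, h𝒬, hC335, hεα, hss, hgrad, hℓ,
    hhol, fun k hk => ?_, h3⟩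
  have hη : 0 < ((c.L : ℝ) ^ k)⁻¹ := by
    have : (0 : ℝ) < c.L := by exact_mod_cast lt_of_lt_of_le one_pos hL1
    positivity
  have hη1 : ((c.L : ℝ) ^ k)⁻¹ ≤ 1 := inv_le_one_of_one_le₀ (one_le_pow₀ (by exact_mod_cast hL1))
  have hk' := hzd k hk
  rw [← hBdef, ← hBhdef] at hk'
  exact thm4TorusAt_print_of_zd (d := 4) (n := Fin N) hL1 k c.Nper hη hη1 hB0 hBc _ hk'

/-- **`LeafSlotAT c → PrintSlot c`** (`2 ≤ c.L`): §3's β-bridge at `β = 1` and dag-n16-c's `printSlotHolder_one_iff`. [folklore] -/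
theorem printSlot_of_leafSlotAT (hL : 2 ≤ c.L) (h : LeafSlotAT c) : PrintSlot c :=
  (printSlotHolder_one_iff c).mp (printSlotHolder_of_leafSlotHolderAT c hL zero_le_one h)

/-- **`LeafSlotHolderMSAT c β → PrintSlotHolderMS c β`** (`2 ≤ c.L`, `0 ≤ β`) — this seat's `printSlotHolderMS_of_leafSlotHolderMS` with the univ-keyed multi-scale
`ℤᵈ` step replaced by F48's `thm4TorusAt_printMS_of_leaf_allTorusPinned`, then dag-n16-c's `thm4TorusAt_printMS_of_zd`. [folklore] -/
theorem printSlotHolderMS_of_leafSlotHolderMSAT (hL : 2 ≤ c.L) {β : ℝ} (hβ : 0 ≤ β) (h : LeafSlotHolderMSAT c β) : PrintSlotHolderMS c β := by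
  letI : CStarAlgebra (Matrix (Fin N) (Fin N) ℂ) := {}
  haveI : Nonempty (Fin N) := ⟨⟨0, Nat.pos_of_ne_zero (NeZero.ne N)⟩⟩
  obtain ⟨len, c₁, c₁', B₁', cP, C₂, B₀β, inp, B, Bh, b', c', α, Mc, C335, 𝒬, hlen, hlenj, hB₁', hBB, hBdef, hBhdef, hBc, hwin,
    hb', hc', hRb, hcF, hα, hA3, hA2, hAs, hAc, hb'α, hc'α, hMc, hMcα, h𝒬, hC335, hεα, hss, hgrad, hℓ, hhol, hT, hP, h3⟩ := h
  have hL1 : 1 ≤ c.L := le_trans one_le_two hL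
  have hB0 : 0 ≤ B := by rw [hBdef]; have := inp.B₀_pos.le; positivity
  have hzd := thm4TorusAt_printMS_of_leaf_allTorusPinned (d := 4) (n := Fin N) (by norm_num) hL hβ hlen hlenj hB₁' hBB hwin
    (fun k => Reg335Zd (((c.L : ℝ) ^ k)⁻¹) c.L (𝒬 k) C335) hT hP
  refine ⟨c₁', B, Bh, b', c', α, Mc, C335, 𝒬, hb', hc', hRb, hcF, hα, hA3, hA2, hAs, hAc, hb'α, hc'α, hMc, hMcα, h𝒬, hC335, hεα, hss, hgrad, hℓ,
    hhol, fun k hk => ?_, h3⟩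
  have hη : 0 < ((c.L : ℝ) ^ k)⁻¹ := by
    have : (0 : ℝ) < c.L := by exact_mod_cast lt_of_lt_of_le one_pos hL1
    positivity
  have hη1 : ((c.L : ℝ) ^ k)⁻¹ ≤ 1 := inv_le_one_of_one_le₀ (one_le_pow₀ (by exact_mod_cast hL1))
  have hk' := hzd k hk
  rw [← hBdef, ← hBhdef] at hk'
  exact thm4TorusAt_printMS_of_zd (d := 4) (n := Fin N) hL1 k c.Nper hη hη1 hB0 hBc _ hk'

end Bridges

/-! ## §4 The one-application closers in the AT-keyed leaf currency -/

section Closers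

variable {N : ℕ} [NeZero N] {c : NE3Carriers N}

/-- **`InEndRegimeH c → LeafSlotHolderAT c β → N16HolderAt c β`** (`0 ≤ β ≤ 1`; §3 + dag-n16-c's `n16HolderAt_of_inEndRegimeH_printSlotHolder`). [folklore] -/
theorem n16HolderAt_of_inEndRegimeH_leafSlotHolderAT (hreg : InEndRegimeH c) {β : ℝ} (hβ0 : 0 ≤ β) (hβ1 : β ≤ 1) (hslot : LeafSlotHolderAT c β) :
    N16HolderAt c β :=
  n16HolderAt_of_inEndRegimeH_printSlotHolder hreg hβ1 (printSlotHolder_of_leafSlotHolderAT c hreg.1 hβ0 hslot)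

/-- **`InEndRegime c → LeafSlotAT c → N16At c`** — THE CLOSER OF RECORD at the sub-index (§3 + this seat's `n16At_of_inEndRegime_printSlot`). [folklore] -/
theorem n16At_of_inEndRegime_leafSlotAT (hreg : InEndRegime c) (hslot : LeafSlotAT c) : N16At c :=
  n16At_of_inEndRegime_printSlot hreg (printSlot_of_leafSlotAT c hreg.1 hslot)

/-- **`InEndRegimeH c → LeafSlotAT c → N16At c`** (the β-uniform regime also closes the slot of record; `n16HolderAt_one_iff`). [folklore] -/
theorem n16At_of_inEndRegimeH_leafSlotAT (hreg : InEndRegimeH c) (hslot : LeafSlotAT c) : N16At c :=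
  (n16HolderAt_one_iff c).mp (n16HolderAt_of_inEndRegimeH_leafSlotHolderAT hreg zero_le_one le_rfl hslot)

/-- **`InEndRegimeHMS c → LeafSlotHolderMSAT c β → N16HolderMSAt c β`** (`0 ≤ β ≤ 1`; §3 + (E1-MS)'s `n16HolderMSAt_of_inEndRegimeHMS_printSlotHolderMS`). [folklore] -/
theorem n16HolderMSAt_of_inEndRegimeHMS_leafSlotHolderMSAT (hreg : InEndRegimeHMS c) {β : ℝ} (hβ0 : 0 ≤ β) (hβ1 : β ≤ 1) (hslot : LeafSlotHolderMSAT c β) :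
    N16HolderMSAt c β :=
  n16HolderMSAt_of_inEndRegimeHMS_printSlotHolderMS hreg hβ0 hβ1 (printSlotHolderMS_of_leafSlotHolderMSAT c hreg.1 hβ0 hslot)

/-- **`InEndRegimeHMS c → LeafSlotHolderAT c β → N16HolderAt c β`** (through `inEndRegimeH_of_inEndRegimeHMS`). [folklore] -/
theorem n16HolderAt_of_inEndRegimeHMS_leafSlotHolderAT (hreg : InEndRegimeHMS c) {β : ℝ} (hβ0 : 0 ≤ β) (hβ1 : β ≤ 1) (hslot : LeafSlotHolderAT c β) :
    N16HolderAt c β :=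
  n16HolderAt_of_inEndRegimeH_leafSlotHolderAT (inEndRegimeH_of_inEndRegimeHMS hreg) hβ0 hβ1 hslot

/-- **`InEndRegimeHMS c → LeafSlotAT c → N16At c`**. [folklore] -/
theorem n16At_of_inEndRegimeHMS_leafSlotAT (hreg : InEndRegimeHMS c) (hslot : LeafSlotAT c) : N16At c :=
  n16At_of_inEndRegimeH_leafSlotAT (inEndRegimeH_of_inEndRegimeHMS hreg) hslot

end Closers

/-! ## §5 The knits at any rate-record predicate, AT-keyed leaf currency (`RRec`-generic) -/

section Knits

variable {N : ℕ} [NeZero N] (RRec : RateRecordPred N)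

/-- **`S_N16Holder β RRec` FROM THE β-UNIFORM REGIME AND THE AT-KEYED LEAF β-SLOT AT EVERY BUNDLE OF THE HOME** (`0 ≤ β ≤ 1`). [folklore] -/
theorem s_N16Holder_of_inEndRegimeH_leafSlotHolderAT {β : ℝ} (hβ0 : 0 ≤ β) (hβ1 : β ≤ 1)
    (h : ∀ (F : T4Family) (D : Datum F N) (g₀ : ℕ → ℝ) (os : List (ULoop F)) (R : RateCarriers N), RRec F D g₀ os R →
      InEndRegimeH R.ne3 ∧ LeafSlotHolderAT R.ne3 β) :
    S_N16Holder β RRec :=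
  fun F D g₀ os R hR => n16HolderAt_of_inEndRegimeH_leafSlotHolderAT (h F D g₀ os R hR).1 hβ0 hβ1 (h F D g₀ os R hR).2

/-- **`S_N16 RRec` (THE STUB OF RECORD) FROM THE REGIME OF RECORD AND THE AT-KEYED LEAF SLOT AT EVERY BUNDLE OF THE HOME.** [folklore] -/
theorem s_N16_of_inEndRegime_leafSlotAT
    (h : ∀ (F : T4Family) (D : Datum F N) (g₀ : ℕ → ℝ) (os : List (ULoop F)) (R : RateCarriers N), RRec F D g₀ os R →
      InEndRegime R.ne3 ∧ LeafSlotAT R.ne3) :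
    S_N16 RRec :=
  fun F D g₀ os R hR => n16At_of_inEndRegime_leafSlotAT (h F D g₀ os R hR).1 (h F D g₀ os R hR).2

/-- **`S_N16HolderMS β RRec` FROM THE MS REGIME AND THE AT-KEYED MS LEAF β-SLOT AT EVERY BUNDLE OF THE HOME** (`0 ≤ β ≤ 1`). [folklore] -/
theorem s_N16HolderMS_of_inEndRegimeHMS_leafSlotHolderMSAT {β : ℝ} (hβ0 : 0 ≤ β) (hβ1 : β ≤ 1)
    (h : ∀ (F : T4Family) (D : Datum F N) (g₀ : ℕ → ℝ) (os : List (ULoop F)) (R : RateCarriers N), RRec F D g₀ os R →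
      InEndRegimeHMS R.ne3 ∧ LeafSlotHolderMSAT R.ne3 β) :
    S_N16HolderMS β RRec :=
  fun F D g₀ os R hR => n16HolderMSAt_of_inEndRegimeHMS_leafSlotHolderMSAT (h F D g₀ os R hR).1 hβ0 hβ1 (h F D g₀ os R hR).2

end Knits

end

end Summit.QuantumFields.YangMills.BalabanUVNodes.N16LeafSlotAllTorus
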